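import Literature.MathematicalPhysics.QuantumFieldTheory.Balaban1983to89.B9Thm314WholeReadingCalculus

/-!
# `Balaban1983to89.B9Thm314WholeReadingLattice` — NODE 00's bond-sector READING functionals ARE reading functionals (block sup, cut-off L²
# norm, covariant Hölder quotient) and the covariant differences ∇_U, ∇*_U, Δ_U ARE local post-maps: the lattice instances of
# `B9Thm314WholeReadingCalculus`

T. Bałaban, *Propagators for lattice gauge theories in a background field*, Commun. Math. Phys. **99** (1985) 389–434
[`Balaban1985BackgroundPropagators`, "B9"].

statement-level skeleton of published theorems with citation tags; proofs where landed; nothing here is a claim about the Yang–Mills mass gap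

THE PRINTED LOCI (verbatim).  p. 397, (3.39)–(3.40): *"|A| = max_μ sup_x |A_μ(x)| … the Hölder norm … sup_{x≠x′} |x − x′|^{−α}
|A(x) − U(Γ_{x,x′})A(x′)U(Γ_{x,x′})⁻¹|"*; p. 398 (3.46): the L² norms *"‖hG(U)J‖, …"* with a cut-off h; (3.3) p. 390, (3.8) p. 392, (3.23)
p. 395: the covariant differences ∇_{U,μ}, ∇*_{U,μ} and the covariant Laplacian.

THE POINT.  NODE 00's operator layer (`Node00.OpsYOfLetters`, def-Y) reads an `𝔸`-valued letter through `supInB` (block sup), `l2OfY`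
(cut-off L² norm), `holderQB` (covariant Hölder quotient (3.40) with the transporter R(U(Γ_{x,x′}))), after the covariant differences `cdB`,
`cdsB`, `lapB`.  THIS FILE proves, at a k-level index `i` (fine bonds `Node00.FBondY i`, backgrounds `Node00.CfgY 𝔸 i`):
* §1 one-step neighbourhoods `nb1 S` of a set of fine bonds (`fwd ∕ bwd` shifts; `subset_nb1`, `fwd_mem_nb1`, `bwd_mem_nb1`, `nb1_mono`);
* §2 ‖R(U)X‖ ≤ ‖U‖‖U⁻¹‖‖X‖ (`norm_R_le ∕ norm_R_inv_le`) and a uniform bound `unitBound U` over the finitely many bond variables;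
* §3 ★ `isLocalOp_cdB ∕ isLocalOp_cdsB` ((3.3)∕(3.8) read `nb1 S`), `isLocalOp_lapB` ((3.23) reads `nb1 (nb1 S)`);
* §4 ★ `isReadingFn_supInB` (read set: the block, constant 1), `sqrt_sum_sq_add_le` (Minkowski), ★ `isReadingFn_l2OfY` (read set: supp h),
  ★ `isReadingFn_holderQB` (read set: supp ζ; subadditive because the transporter is additive);
* §5 global bounds for boundedness over the unit ball of directions: `norm_liftY_pi_le`, `exists_opBound` (a ℂ-linear letter on the finite
  lattice is bounded, 𝔸 finite-dimensional as the record's `Matrix (Fin N) (Fin N) ℂ`), `exists_global_of_isLocalOp`, `exists_global_of_isReadingFn`.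

HONEST SCOPE.  Elementary estimates on a finite lattice (kernel-checked); nothing of print asserted; NOT a node discharge, NOT summit progress;
one finite lattice paper; nothing continuum, nothing about the mass gap.  Cell `pub-ymgap` (D-0062), node N06 [B9], N06-ASSIGNMENT v1 rows 22–23
(successor file of bundle F8), seat `pub-ymgap-dag-n06-m` (g3), 2026-08-27.
-/

noncomputable section

namespace Literature.MathematicalPhysics.QuantumFieldTheory.Balaban1983to89.B9Thm314WholeReadingLattice

open Finset
open B9Eq39Adjoint (R R_add R_neg R_zero)
open B6GlobalChartV1 (PV blkV1)
open B6KLevelCensusIndexV1 (KIdx Adm)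
open B9BackgroundsKLevelV1 (shiftsV1)
open Node00 (FBondY BlkY CfgY BallY liftY cdB cdsB lapB supInB l2OfY holderQB)
open B9Thm314WholeReadingCalculus

section Lattice

variable {d ℓ : ℕ} {hd : 1 ≤ d + 1} {hL : Odd (ℓ + 1) ∧ 1 < ℓ + 1} {b₀ b₁ : ℝ}
variable {𝔸 : Type} [NormedRing 𝔸] [NormedAlgebra ℂ 𝔸] [CompleteSpace 𝔸]
variable (i : KIdx d ℓ hd hL b₀ b₁)

/-! ## §1 One-step neighbourhoods of a set of fine bonds -/

/-- the bond shifted forward along μ (same direction): the second argument of (3.3). [cite: Balaban1985BackgroundPropagators, (3.3) p.390] -/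
def fwd (μ : Fin (d + 1)) (b : FBondY i) : FBondY i := ⟨shiftsV1 (PV d ℓ i.m i.K hd hL) μ b.src, b.dir⟩

/-- the bond shifted backward along μ: the second argument of (3.8)'s ∇*. [cite: Balaban1985BackgroundPropagators, (3.8) p.392] -/
def bwd (μ : Fin (d + 1)) (b : FBondY i) : FBondY i := ⟨(shiftsV1 (PV d ℓ i.m i.K hd hL) μ).symm b.src, b.dir⟩

/-- **THE ONE-STEP NEIGHBOURHOOD** of a set of fine bonds: the set together with all forward and backward shifts of its bonds — the read set of
one covariant difference. [cite: Balaban1985BackgroundPropagators, (3.3) p.390 + (3.8) p.392, bookkeeping] -/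
def nb1 (S : Set (FBondY i)) : Set (FBondY i) :=
  {x | x ∈ S ∨ ∃ b ∈ S, ∃ μ : Fin (d + 1), x = fwd i μ b ∨ x = bwd i μ b}

variable {i}

/-- S ⊆ nb1 S. [cite: Balaban1985BackgroundPropagators, (3.3) p.390, bookkeeping] -/
theorem subset_nb1 (S : Set (FBondY i)) : S ⊆ nb1 i S := fun _ hx => Or.inl hx

/-- forward shifts of S lie in nb1 S. [cite: Balaban1985BackgroundPropagators, (3.3) p.390, bookkeeping] -/
theorem fwd_mem_nb1 {S : Set (FBondY i)} {b : FBondY i} (hb : b ∈ S) (μ : Fin (d + 1)) : fwd i μ b ∈ nb1 i S :=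
  Or.inr ⟨b, hb, μ, Or.inl rfl⟩

/-- backward shifts of S lie in nb1 S. [cite: Balaban1985BackgroundPropagators, (3.8) p.392, bookkeeping] -/
theorem bwd_mem_nb1 {S : Set (FBondY i)} {b : FBondY i} (hb : b ∈ S) (μ : Fin (d + 1)) : bwd i μ b ∈ nb1 i S :=
  Or.inr ⟨b, hb, μ, Or.inr rfl⟩

/-- nb1 is monotone. [cite: Balaban1985BackgroundPropagators, (3.3) p.390, bookkeeping] -/
theorem nb1_mono {S T : Set (FBondY i)} (h : S ⊆ T) : nb1 i S ⊆ nb1 i T := by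
  rintro x (hx | ⟨b, hb, μ, hμ⟩)
  · exact Or.inl (h hx)
  · exact Or.inr ⟨b, h hb, μ, hμ⟩

/-! ## §2 The bond variables: ‖R(U)X‖ ≤ ‖U‖‖U⁻¹‖‖X‖ and a uniform bound over the lattice -/

omit [NormedAlgebra ℂ 𝔸] [CompleteSpace 𝔸] in
/-- ‖UXU⁻¹‖ ≤ ‖U‖·‖U⁻¹‖·‖X‖. [cite: Balaban1985BackgroundPropagators, p.390 («R(U)X = UXU⁻¹»), bookkeeping] -/
theorem norm_R_le (u : 𝔸ˣ) (X : 𝔸) : ‖R u X‖ ≤ ‖(u : 𝔸)‖ * ‖((u⁻¹ : 𝔸ˣ) : 𝔸)‖ * ‖X‖ := by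
  rw [B9Eq39Adjoint.R_def]
  calc ‖(u : 𝔸) * X * ((u⁻¹ : 𝔸ˣ) : 𝔸)‖ ≤ ‖(u : 𝔸) * X‖ * ‖((u⁻¹ : 𝔸ˣ) : 𝔸)‖ := norm_mul_le _ _
    _ ≤ ‖(u : 𝔸)‖ * ‖X‖ * ‖((u⁻¹ : 𝔸ˣ) : 𝔸)‖ := mul_le_mul_of_nonneg_right (norm_mul_le _ _) (norm_nonneg _)
    _ = ‖(u : 𝔸)‖ * ‖((u⁻¹ : 𝔸ˣ) : 𝔸)‖ * ‖X‖ := by ring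

omit [NormedAlgebra ℂ 𝔸] [CompleteSpace 𝔸] in
/-- ‖U⁻¹XU‖ ≤ ‖U‖·‖U⁻¹‖·‖X‖. [cite: Balaban1985BackgroundPropagators, (3.5) p.391 («U(x, x−e_μ) = U(x−e_μ, x)⁻¹»), bookkeeping] -/
theorem norm_R_inv_le (u : 𝔸ˣ) (X : 𝔸) : ‖R u⁻¹ X‖ ≤ ‖(u : 𝔸)‖ * ‖((u⁻¹ : 𝔸ˣ) : 𝔸)‖ * ‖X‖ := by
  have h := norm_R_le u⁻¹ X
  rw [inv_inv] at h
  linarith [h, mul_comm ‖(u : 𝔸)‖ ‖((u⁻¹ : 𝔸ˣ) : 𝔸)‖]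

/-- **A UNIFORM BOUND FOR ‖U‖·‖U⁻¹‖ over the finitely many bond variables of a background** (for the record's SU(N) every summand is 1; in
general a number depending on U). [cite: Balaban1985BackgroundPropagators, (3.1) p.390 (the bond variables), bookkeeping] -/
def unitBound (U : CfgY 𝔸 i) : ℝ :=
  ∑ μ : Fin (d + 1), ∑ s : Site (PV d ℓ i.m i.K hd hL) 0, ‖((U μ s : 𝔸ˣ) : 𝔸)‖ * ‖(((U μ s)⁻¹ : 𝔸ˣ) : 𝔸)‖

/-- `unitBound U ≥ 0`. [cite: Balaban1985BackgroundPropagators, (3.1) p.390, bookkeeping] -/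
theorem unitBound_nonneg (U : CfgY 𝔸 i) : 0 ≤ unitBound (i := i) U :=
  Finset.sum_nonneg fun _ _ => Finset.sum_nonneg fun _ _ => mul_nonneg (norm_nonneg _) (norm_nonneg _)

/-- each ‖U_μ(s)‖·‖U_μ(s)⁻¹‖ is below the uniform bound. [cite: Balaban1985BackgroundPropagators, (3.1) p.390, bookkeeping] -/
theorem prod_le_unitBound (U : CfgY 𝔸 i) (μ : Fin (d + 1)) (s : Site (PV d ℓ i.m i.K hd hL) 0) :
    ‖((U μ s : 𝔸ˣ) : 𝔸)‖ * ‖(((U μ s)⁻¹ : 𝔸ˣ) : 𝔸)‖ ≤ unitBound (i := i) U := by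
  unfold unitBound
  refine le_trans ?_ (Finset.single_le_sum (f := fun μ => ∑ s : Site (PV d ℓ i.m i.K hd hL) 0,
    ‖((U μ s : 𝔸ˣ) : 𝔸)‖ * ‖(((U μ s)⁻¹ : 𝔸ˣ) : 𝔸)‖)
    (fun μ _ => Finset.sum_nonneg fun _ _ => mul_nonneg (norm_nonneg _) (norm_nonneg _)) (Finset.mem_univ μ))
  exact Finset.single_le_sum (f := fun s => ‖((U μ s : 𝔸ˣ) : 𝔸)‖ * ‖(((U μ s)⁻¹ : 𝔸ˣ) : 𝔸)‖)
    (fun _ _ => mul_nonneg (norm_nonneg _) (norm_nonneg _)) (Finset.mem_univ s)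

/-- ‖R(U_μ(s))X‖ ≤ unitBound U · ‖X‖. [cite: Balaban1985BackgroundPropagators, p.390, bookkeeping] -/
theorem norm_R_cfg_le (U : CfgY 𝔸 i) (μ : Fin (d + 1)) (s : Site (PV d ℓ i.m i.K hd hL) 0) (X : 𝔸) :
    ‖R (U μ s) X‖ ≤ unitBound (i := i) U * ‖X‖ :=
  (norm_R_le _ _).trans (mul_le_mul_of_nonneg_right (prod_le_unitBound U μ s) (norm_nonneg _))

/-- ‖R(U_μ(s)⁻¹)X‖ ≤ unitBound U · ‖X‖. [cite: Balaban1985BackgroundPropagators, (3.5) p.391, bookkeeping] -/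
theorem norm_R_cfg_inv_le (U : CfgY 𝔸 i) (μ : Fin (d + 1)) (s : Site (PV d ℓ i.m i.K hd hL) 0) (X : 𝔸) :
    ‖R (U μ s)⁻¹ X‖ ≤ unitBound (i := i) U * ‖X‖ :=
  (norm_R_inv_le _ _).trans (mul_le_mul_of_nonneg_right (prod_le_unitBound U μ s) (norm_nonneg _))

/-! ## §3 The covariant differences are local post-maps -/

omit [CompleteSpace 𝔸] in
/-- the norm of the unit factor `c_f` (as a complex scalar) is |c_f|. [cite: Balaban1985BackgroundPropagators, (3.39) p.397 (physical units), bookkeeping] -/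
theorem norm_cf : ‖((i.cf : ℝ) : ℂ)‖ = |i.cf| := by
  rw [Complex.norm_real, Real.norm_eq_abs]

/-- ★ **(3.3) ∇_{U,μ} on the bond sector is a local post-map** reading the one-step neighbourhood: additive, odd, and
‖(∇_{U,μ}Φ)(b)‖ ≤ |c_f|(unitBound U + 1)·t on S when ‖Φ‖ ≤ t on nb1 S. [cite: Balaban1985BackgroundPropagators, (3.3) p.390] -/
theorem isLocalOp_cdB (U : CfgY 𝔸 i) (μ : Fin (d + 1)) (S : Set (FBondY i)) : IsLocalOp (cdB i U μ) S (nb1 i S) where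
  add Φ Ψ := by
    funext b
    simp only [cdB, B9Eq39Adjoint.covD, Pi.add_apply, R_add, smul_add, smul_sub]
    abel
  neg Φ := by
    funext b
    simp only [cdB, B9Eq39Adjoint.covD, Pi.neg_apply, R_neg, smul_neg, smul_sub]
    abel
  lip := by
    refine ⟨|i.cf| * (unitBound (i := i) U + 1),
      mul_nonneg (abs_nonneg _) (add_nonneg (unitBound_nonneg (i := i) U) zero_le_one), fun Φ t ht hΦ b hb => ?_⟩
    have h1 : ‖Φ (fwd i μ b)‖ ≤ t := hΦ _ (fwd_mem_nb1 hb μ)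
    have h2 : ‖Φ b‖ ≤ t := hΦ _ (subset_nb1 S hb)
    simp only [cdB, B9Eq39Adjoint.covD]
    calc ‖((i.cf : ℝ) : ℂ) • (R (U μ b.src) (Φ ⟨shiftsV1 (PV d ℓ i.m i.K hd hL) μ b.src, b.dir⟩) - Φ ⟨b.src, b.dir⟩)‖
        ≤ ‖((i.cf : ℝ) : ℂ)‖ * (‖R (U μ b.src) (Φ ⟨shiftsV1 (PV d ℓ i.m i.K hd hL) μ b.src, b.dir⟩)‖ + ‖Φ ⟨b.src, b.dir⟩‖) :=
          (norm_smul_le _ _).trans (mul_le_mul_of_nonneg_left (norm_sub_le _ _) (norm_nonneg _))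
      _ ≤ |i.cf| * (unitBound (i := i) U * t + t) := by
          rw [norm_cf]
          refine mul_le_mul_of_nonneg_left (add_le_add ?_ h2) (abs_nonneg _)
          exact (norm_R_cfg_le U μ b.src _).trans (mul_le_mul_of_nonneg_left h1 (unitBound_nonneg (i := i) U))
      _ = |i.cf| * (unitBound (i := i) U + 1) * t := by ring

/-- ★ **(3.8) ∇*_{U,μ} on the bond sector is a local post-map** reading the one-step neighbourhood. [cite: Balaban1985BackgroundPropagators, (3.8) p.392] -/
theorem isLocalOp_cdsB (U : CfgY 𝔸 i) (μ : Fin (d + 1)) (S : Set (FBondY i)) : IsLocalOp (cdsB i U μ) S (nb1 i S) where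
  add Φ Ψ := by
    funext b
    simp only [cdsB, B9Eq39Adjoint.covDstar, Pi.add_apply, R_add, smul_add, smul_sub]
    abel
  neg Φ := by
    funext b
    simp only [cdsB, B9Eq39Adjoint.covDstar, Pi.neg_apply, R_neg, smul_neg, smul_sub]
    abel
  lip := by
    refine ⟨|i.cf| * (unitBound (i := i) U + 1),
      mul_nonneg (abs_nonneg _) (add_nonneg (unitBound_nonneg (i := i) U) zero_le_one), fun Φ t ht hΦ b hb => ?_⟩
    have h1 : ‖Φ (bwd i μ b)‖ ≤ t := hΦ _ (bwd_mem_nb1 hb μ)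
    have h2 : ‖Φ b‖ ≤ t := hΦ _ (subset_nb1 S hb)
    simp only [cdsB, B9Eq39Adjoint.covDstar]
    calc ‖((i.cf : ℝ) : ℂ) • (R (U μ ((shiftsV1 (PV d ℓ i.m i.K hd hL) μ).symm b.src))⁻¹
            (Φ ⟨(shiftsV1 (PV d ℓ i.m i.K hd hL) μ).symm b.src, b.dir⟩) - Φ ⟨b.src, b.dir⟩)‖
        ≤ ‖((i.cf : ℝ) : ℂ)‖ * (‖R (U μ ((shiftsV1 (PV d ℓ i.m i.K hd hL) μ).symm b.src))⁻¹
            (Φ ⟨(shiftsV1 (PV d ℓ i.m i.K hd hL) μ).symm b.src, b.dir⟩)‖ + ‖Φ ⟨b.src, b.dir⟩‖) :=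
          (norm_smul_le _ _).trans (mul_le_mul_of_nonneg_left (norm_sub_le _ _) (norm_nonneg _))
      _ ≤ |i.cf| * (unitBound (i := i) U * t + t) := by
          rw [norm_cf]
          refine mul_le_mul_of_nonneg_left (add_le_add ?_ h2) (abs_nonneg _)
          exact (norm_R_cfg_inv_le U μ _ _).trans (mul_le_mul_of_nonneg_left h1 (unitBound_nonneg (i := i) U))
      _ = |i.cf| * (unitBound (i := i) U + 1) * t := by ring

/-- ★ **(3.23) the covariant Laplacian Σ_μ ∇*_{U,μ}∇_{U,μ} on the bond sector is a local post-map** reading the two-step neighbourhood.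
[cite: Balaban1985BackgroundPropagators, (3.23) p.395] -/
theorem isLocalOp_lapB (U : CfgY 𝔸 i) (S : Set (FBondY i)) : IsLocalOp (lapB i U) S (nb1 i (nb1 i S)) := by
  have h : IsLocalOp (fun Φ => ∑ μ : Fin (d + 1), cdsB i U μ (cdB i U μ Φ)) S (nb1 i (nb1 i S)) :=
    IsLocalOp.sum Finset.univ fun μ _ => (isLocalOp_cdsB U μ S).comp (isLocalOp_cdB U μ (nb1 i S))
  have hfun : (lapB i U) = fun Φ => ∑ μ : Fin (d + 1), cdsB i U μ (cdB i U μ Φ) := by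
    funext Φ b
    simp only [lapB, Finset.sum_apply]
  rw [hfun]
  exact h

/-! ## §4 The three functionals are reading functionals -/

omit [NormedAlgebra ℂ 𝔸] [CompleteSpace 𝔸] in
/-- ★ **THE BLOCK SUP `sup_{x ∈ B(y)} ‖Φ(x)‖` is a reading functional** with read set the block (constant 1).
[cite: Balaban1985BackgroundPropagators, (3.42) p.397 («for x ∈ Δ(y)»)] -/
theorem isReadingFn_supInB (y : BlkY i) : IsReadingFn (supInB i y : (FBondY i → 𝔸) → ℝ) {x | blkV1 i.hN i.D x = y} where
  zero := by simp only [supInB, Pi.zero_apply, norm_zero, Real.iSup_const_zero]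
  add_le Φ Ψ := by
    unfold supInB
    refine Real.iSup_le (fun x => (norm_add_le _ _).trans (add_le_add ?_ ?_))
      (add_nonneg (Real.iSup_nonneg fun _ => norm_nonneg _) (Real.iSup_nonneg fun _ => norm_nonneg _))
    · exact le_ciSup (f := fun x : {x : FBondY i // blkV1 i.hN i.D x = y} => ‖Φ x.1‖) (Set.finite_range _).bddAbove x
    · exact le_ciSup (f := fun x : {x : FBondY i // blkV1 i.hN i.D x = y} => ‖Ψ x.1‖) (Set.finite_range _).bddAbove x
  neg Φ := by simp only [supInB, Pi.neg_apply, norm_neg]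
  lip := ⟨1, zero_le_one, fun Φ t ht hΦ => by
    rw [one_mul]
    exact Real.iSup_le (fun x => hΦ x.1 x.2) ht⟩

omit [NormedAlgebra ℂ 𝔸] [CompleteSpace 𝔸] in
/-- Minkowski for the weighted sum of squares: √Σ(a + b)² ≤ √Σa² + √Σb². [cite: Balaban1985BackgroundPropagators, (3.46) p.398 (L² norms), bookkeeping] -/
theorem sqrt_sum_sq_add_le {ι : Type} (s : Finset ι) (a b : ι → ℝ) :
    Real.sqrt (∑ x ∈ s, (a x + b x) ^ 2) ≤ Real.sqrt (∑ x ∈ s, a x ^ 2) + Real.sqrt (∑ x ∈ s, b x ^ 2) := by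
  set A := Real.sqrt (∑ x ∈ s, a x ^ 2) with hA
  set B := Real.sqrt (∑ x ∈ s, b x ^ 2) with hB
  have hA0 : 0 ≤ A := Real.sqrt_nonneg _
  have hB0 : 0 ≤ B := Real.sqrt_nonneg _
  have hcs : ∑ x ∈ s, a x * b x ≤ A * B := Real.sum_mul_le_sqrt_mul_sqrt s a b
  have hsum : ∑ x ∈ s, (a x + b x) ^ 2 = ∑ x ∈ s, a x ^ 2 + 2 * ∑ x ∈ s, a x * b x + ∑ x ∈ s, b x ^ 2 := by
    rw [Finset.mul_sum, ← Finset.sum_add_distrib, ← Finset.sum_add_distrib]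
    exact Finset.sum_congr rfl fun x _ => by ring
  have hA2 : A ^ 2 = ∑ x ∈ s, a x ^ 2 := Real.sq_sqrt (Finset.sum_nonneg fun _ _ => sq_nonneg _)
  have hB2 : B ^ 2 = ∑ x ∈ s, b x ^ 2 := Real.sq_sqrt (Finset.sum_nonneg fun _ _ => sq_nonneg _)
  rw [← Real.sqrt_sq (add_nonneg hA0 hB0)]
  apply Real.sqrt_le_sqrt
  nlinarith

omit [NormedAlgebra ℂ 𝔸] [CompleteSpace 𝔸] in
/-- ★ **THE CUT-OFF L² NORM `(Σ_x (h(x)‖Φ(x)‖)²)^{1/2}` is a reading functional** with read set supp h (constant √Σh²).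
[cite: Balaban1985BackgroundPropagators, (3.46) p.398] -/
theorem isReadingFn_l2OfY (h : FBondY i → ℝ) : IsReadingFn (l2OfY h : (FBondY i → 𝔸) → ℝ) {x | h x ≠ 0} where
  zero := by simp only [l2OfY, Pi.zero_apply, norm_zero, mul_zero, ne_eq, OfNat.ofNat_ne_zero, not_false_eq_true,
    zero_pow, Finset.sum_const_zero, Real.sqrt_zero]
  add_le Φ Ψ := by
    unfold l2OfY
    refine le_trans (Real.sqrt_le_sqrt (Finset.sum_le_sum fun x _ => ?_))
      (sqrt_sum_sq_add_le Finset.univ (fun x => h x * ‖Φ x‖) (fun x => h x * ‖Ψ x‖))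
    have h1 : (h x * ‖(Φ + Ψ) x‖) ^ 2 = h x ^ 2 * ‖Φ x + Ψ x‖ ^ 2 := by rw [Pi.add_apply]; ring
    have h2 : (h x * ‖Φ x‖ + h x * ‖Ψ x‖) ^ 2 = h x ^ 2 * (‖Φ x‖ + ‖Ψ x‖) ^ 2 := by ring
    rw [h1, h2]
    exact mul_le_mul_of_nonneg_left (pow_le_pow_left₀ (norm_nonneg _) (norm_add_le _ _) 2) (sq_nonneg _)
  neg Φ := by simp only [l2OfY, Pi.neg_apply, norm_neg]
  lip := by
    refine ⟨Real.sqrt (∑ x, h x ^ 2), Real.sqrt_nonneg _, fun Φ t ht hΦ => ?_⟩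
    unfold l2OfY
    have hle : ∑ x, (h x * ‖Φ x‖) ^ 2 ≤ ∑ x, (h x * t) ^ 2 := by
      refine Finset.sum_le_sum fun x _ => ?_
      by_cases hx : h x = 0
      · simp [hx]
      · have := hΦ x hx
        rw [mul_pow, mul_pow]
        exact mul_le_mul_of_nonneg_left (pow_le_pow_left₀ (norm_nonneg _) this 2) (sq_nonneg _)
    refine (Real.sqrt_le_sqrt hle).trans (le_of_eq ?_)
    have : ∑ x, (h x * t) ^ 2 = (∑ x, h x ^ 2) * t ^ 2 := by rw [Finset.sum_mul]; exact Finset.sum_congr rfl fun x _ => by ring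
    rw [this, Real.sqrt_mul (Finset.sum_nonneg fun _ _ => sq_nonneg _), Real.sqrt_sq ht]

/-- the weight of the Hölder quotient is nonnegative. [cite: Balaban1985BackgroundPropagators, (3.40) p.397, bookkeeping] -/
private theorem hweight_nonneg (α : ℝ) (q : FBondY i × FBondY i) :
    0 ≤ ((((LatticeFieldCalculus.supDist q.1.src q.2.src : ℕ) : ℝ)) * |i.cf|⁻¹) ^ (-α) :=
  Real.rpow_nonneg (mul_nonneg (Nat.cast_nonneg _) (inv_nonneg.2 (abs_nonneg _))) _

omit [CompleteSpace 𝔸] in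
/-- ‖(r : ℂ) • X‖ ≤ |r|·‖X‖. [cite: Balaban1985BackgroundPropagators, (3.40) p.397, bookkeeping] -/
private theorem norm_real_smul_le (r : ℝ) (X : 𝔸) : ‖((r : ℝ) : ℂ) • X‖ ≤ |r| * ‖X‖ := by
  refine (norm_smul_le _ _).trans (le_of_eq ?_)
  rw [Complex.norm_real, Real.norm_eq_abs]

omit [CompleteSpace 𝔸] in
/-- ★ **THE COVARIANT HÖLDER QUOTIENT (3.40) of `ζΦ` is a reading functional** with read set supp ζ: the transporter R(U(Γ_{x,x′})) is
additive, so the quotient is subadditive and even; each admissible pair contributes at most w·(|ζ(x)| + ‖U‖‖U⁻¹‖|ζ(x′)|)·t when ‖Φ‖ ≤ t on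
supp ζ. [cite: Balaban1985BackgroundPropagators, (3.40) p.397] -/
theorem isReadingFn_holderQB (par : Site (PV d ℓ i.m i.K hd hL) 0 → Site (PV d ℓ i.m i.K hd hL) 0 → 𝔸ˣ) (α : ℝ) (ζ : FBondY i → ℝ) :
    IsReadingFn (holderQB i par α ζ : (FBondY i → 𝔸) → ℝ) {x | ζ x ≠ 0} where
  zero := by
    unfold holderQB
    simp only [Pi.zero_apply, smul_zero, R_zero, sub_zero, norm_zero, mul_zero, ite_self, Real.iSup_const_zero]
  add_le Φ Ψ := by
    unfold holderQB
    have hbd : ∀ Θ : FBondY i → 𝔸, BddAbove (Set.range fun q : FBondY i × FBondY i =>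
        if Adm i q.1 q.2 then ((((LatticeFieldCalculus.supDist q.1.src q.2.src : ℕ) : ℝ)) * |i.cf|⁻¹) ^ (-α) *
          ‖((ζ q.1 : ℝ) : ℂ) • Θ q.1 - R (par q.1.src q.2.src) (((ζ q.2 : ℝ) : ℂ) • Θ q.2)‖ else 0) :=
      fun Θ => (Set.finite_range _).bddAbove
    have hnn : ∀ Θ : FBondY i → 𝔸, ∀ q : FBondY i × FBondY i, 0 ≤
        (if Adm i q.1 q.2 then ((((LatticeFieldCalculus.supDist q.1.src q.2.src : ℕ) : ℝ)) * |i.cf|⁻¹) ^ (-α) *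
          ‖((ζ q.1 : ℝ) : ℂ) • Θ q.1 - R (par q.1.src q.2.src) (((ζ q.2 : ℝ) : ℂ) • Θ q.2)‖ else 0) := by
      intro Θ q
      split_ifs
      · exact mul_nonneg (hweight_nonneg (i := i) α q) (norm_nonneg _)
      · exact le_rfl
    refine Real.iSup_le (fun q => ?_) (add_nonneg (Real.iSup_nonneg (hnn Φ)) (Real.iSup_nonneg (hnn Ψ)))
    refine le_trans ?_ (add_le_add (le_ciSup (hbd Φ) q) (le_ciSup (hbd Ψ) q))
    split_ifs with hq
    · rw [← mul_add]
      refine mul_le_mul_of_nonneg_left ?_ (hweight_nonneg (i := i) α q)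
      have : ((ζ q.1 : ℝ) : ℂ) • (Φ + Ψ) q.1 - R (par q.1.src q.2.src) (((ζ q.2 : ℝ) : ℂ) • (Φ + Ψ) q.2) =
          (((ζ q.1 : ℝ) : ℂ) • Φ q.1 - R (par q.1.src q.2.src) (((ζ q.2 : ℝ) : ℂ) • Φ q.2)) +
            (((ζ q.1 : ℝ) : ℂ) • Ψ q.1 - R (par q.1.src q.2.src) (((ζ q.2 : ℝ) : ℂ) • Ψ q.2)) := by
        simp only [Pi.add_apply, smul_add, R_add]
        abel
      rw [this]
      exact norm_add_le _ _
    · simp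
  neg Φ := by
    unfold holderQB
    congr 1
    funext q
    split_ifs
    · congr 1
      rw [Pi.neg_apply, Pi.neg_apply, smul_neg, smul_neg, R_neg, ← norm_neg]
      congr 1
      abel
    · rfl
  lip := by
    refine ⟨∑ q : FBondY i × FBondY i, ((((LatticeFieldCalculus.supDist q.1.src q.2.src : ℕ) : ℝ)) * |i.cf|⁻¹) ^ (-α) *
        (|ζ q.1| + ‖((par q.1.src q.2.src : 𝔸ˣ) : 𝔸)‖ * ‖(((par q.1.src q.2.src)⁻¹ : 𝔸ˣ) : 𝔸)‖ * |ζ q.2|),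
      Finset.sum_nonneg fun q _ => mul_nonneg (hweight_nonneg (i := i) α q) (by positivity), fun Φ t ht hΦ => ?_⟩
    have hcoef : ∀ q : FBondY i × FBondY i, 0 ≤ ((((LatticeFieldCalculus.supDist q.1.src q.2.src : ℕ) : ℝ)) * |i.cf|⁻¹) ^ (-α) *
        (|ζ q.1| + ‖((par q.1.src q.2.src : 𝔸ˣ) : 𝔸)‖ * ‖(((par q.1.src q.2.src)⁻¹ : 𝔸ˣ) : 𝔸)‖ * |ζ q.2|) :=
      fun q => mul_nonneg (hweight_nonneg (i := i) α q) (by positivity)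
    have hζ : ∀ x : FBondY i, |ζ x| * ‖Φ x‖ ≤ |ζ x| * t := by
      intro x
      by_cases hx : ζ x = 0
      · simp [hx]
      · exact mul_le_mul_of_nonneg_left (hΦ x hx) (abs_nonneg _)
    unfold holderQB
    refine Real.iSup_le (fun q => ?_) (mul_nonneg (Finset.sum_nonneg fun q _ => hcoef q) ht)
    refine le_trans ?_ (mul_le_mul_of_nonneg_right (Finset.single_le_sum (fun q _ => hcoef q) (Finset.mem_univ q)) ht)
    split_ifs with hq
    · rw [mul_assoc]
      refine mul_le_mul_of_nonneg_left ?_ (hweight_nonneg (i := i) α q)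
      calc ‖((ζ q.1 : ℝ) : ℂ) • Φ q.1 - R (par q.1.src q.2.src) (((ζ q.2 : ℝ) : ℂ) • Φ q.2)‖
          ≤ ‖((ζ q.1 : ℝ) : ℂ) • Φ q.1‖ + ‖R (par q.1.src q.2.src) (((ζ q.2 : ℝ) : ℂ) • Φ q.2)‖ := norm_sub_le _ _
        _ ≤ |ζ q.1| * ‖Φ q.1‖ + ‖((par q.1.src q.2.src : 𝔸ˣ) : 𝔸)‖ * ‖(((par q.1.src q.2.src)⁻¹ : 𝔸ˣ) : 𝔸)‖ *
              (|ζ q.2| * ‖Φ q.2‖) :=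
            add_le_add (norm_real_smul_le _ _) ((norm_R_le _ _).trans
              (mul_le_mul_of_nonneg_left (norm_real_smul_le _ _) (mul_nonneg (norm_nonneg _) (norm_nonneg _))))
        _ ≤ |ζ q.1| * t + ‖((par q.1.src q.2.src : 𝔸ˣ) : 𝔸)‖ * ‖(((par q.1.src q.2.src)⁻¹ : 𝔸ˣ) : 𝔸)‖ * (|ζ q.2| * t) :=
            add_le_add (hζ q.1) (mul_le_mul_of_nonneg_left (hζ q.2) (mul_nonneg (norm_nonneg _) (norm_nonneg _)))
        _ = (|ζ q.1| + ‖((par q.1.src q.2.src : 𝔸ˣ) : 𝔸)‖ * ‖(((par q.1.src q.2.src)⁻¹ : 𝔸ˣ) : 𝔸)‖ * |ζ q.2|) * t := by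
            ring
    · exact mul_nonneg (hcoef q) ht

/-! ## §5 Global bounds (boundedness of the reading over the unit ball of directions) -/

/-- the product-form lift along a direction of the unit ball is bounded by the sup norm of the scalar argument.
[cite: Balaban1985BackgroundPropagators, (3.39) p.397, bookkeeping] -/
theorem norm_liftY_pi_le (J : FBondY i → ℝ) (E : BallY 𝔸) : ‖liftY J (E : 𝔸)‖ ≤ ‖J‖ :=
  (pi_norm_le_iff_of_nonneg (norm_nonneg J)).2 fun x =>
    (Node00.norm_liftY_le J E x).trans (by simpa using norm_le_pi_norm J x)

variable [FiniteDimensional ℂ 𝔸]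

omit [CompleteSpace 𝔸] in
/-- ★ **A ℂ-LINEAR LETTER ON THE FINITE LATTICE IS BOUNDED** (𝔸 finite-dimensional): ‖(TΨ)(x)‖ ≤ C·‖Ψ‖ for some C ≥ 0.
[cite: Balaban1985BackgroundPropagators, (3.27) p.395 (the letters are lattice operators), bookkeeping] -/
theorem exists_opBound (T : (FBondY i → 𝔸) →ₗ[ℂ] (FBondY i → 𝔸)) :
    ∃ C : ℝ, 0 ≤ C ∧ ∀ (Ψ : FBondY i → 𝔸) (x : FBondY i), ‖T Ψ x‖ ≤ C * ‖Ψ‖ := by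
  refine ⟨‖LinearMap.toContinuousLinearMap T‖, norm_nonneg (LinearMap.toContinuousLinearMap T), fun Ψ x => ?_⟩
  calc ‖T Ψ x‖ ≤ ‖T Ψ‖ := norm_le_pi_norm (T Ψ) x
    _ = ‖LinearMap.toContinuousLinearMap T Ψ‖ := by rw [LinearMap.coe_toContinuousLinearMap']
    _ ≤ ‖LinearMap.toContinuousLinearMap T‖ * ‖Ψ‖ := ContinuousLinearMap.le_opNorm _ _

omit [NormedAlgebra ℂ 𝔸] [CompleteSpace 𝔸] [FiniteDimensional ℂ 𝔸] in
/-- a local post-map is globally bounded on its output set: ‖PΦ(x)‖ ≤ C‖Φ‖ for x ∈ S. [cite: Balaban1985BackgroundPropagators, (3.3) p.390, bookkeeping] -/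
theorem exists_global_of_isLocalOp {P : (FBondY i → 𝔸) → (FBondY i → 𝔸)} {S S' : Set (FBondY i)} (h : IsLocalOp P S S') :
    ∃ C : ℝ, 0 ≤ C ∧ ∀ (Φ : FBondY i → 𝔸), ∀ x ∈ S, ‖P Φ x‖ ≤ C * ‖Φ‖ := by
  obtain ⟨C, hC, hl⟩ := h.lip
  exact ⟨C, hC, fun Φ x hx => hl Φ ‖Φ‖ (norm_nonneg _) (fun x' _ => norm_le_pi_norm Φ x') x hx⟩

omit [NormedAlgebra ℂ 𝔸] [CompleteSpace 𝔸] [FiniteDimensional ℂ 𝔸] in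
/-- a reading functional is globally bounded: F(Φ) ≤ C‖Φ‖. [cite: Balaban1985BackgroundPropagators, (3.39) p.397, bookkeeping] -/
theorem exists_global_of_isReadingFn {F : (FBondY i → 𝔸) → ℝ} {S : Set (FBondY i)} (h : IsReadingFn F S) :
    ∃ C : ℝ, 0 ≤ C ∧ ∀ Φ : FBondY i → 𝔸, F Φ ≤ C * ‖Φ‖ := by
  obtain ⟨C, hC, hl⟩ := h.lip
  exact ⟨C, hC, fun Φ => hl Φ ‖Φ‖ (norm_nonneg _) fun x _ => norm_le_pi_norm Φ x⟩

end Lattice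

end Literature.MathematicalPhysics.QuantumFieldTheory.Balaban1983to89.B9Thm314WholeReadingLattice

end
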